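import Summits.BirchSwinnertonDyer.BirchSwinnertonDyer.Theses.PrintX10b
import Summits.BirchSwinnertonDyer.BirchSwinnertonDyer.Theorems.PrintX10bUntiedHowardContainmentOfPrintCore
import Summits.BirchSwinnertonDyer.BirchSwinnertonDyer.Theorems.PrintX10bHowardContainmentAnyClassNumberX10bThm413Hyp
import Literature.NumberTheory.EllipticCurves.HeegnerPointReflectionProofs
import HarnessLib

/-!
# The untied A₃ `HowardContainmentAnyClassNumberX10b` (stmt-BirchSwinnertonDyer-23729) ON ODD-`d_K` FRAMES from the
# route's cite-only print leaves `CGLSHeegnerClassNonvanishing` (27103) and `CGSHowardDivisibilityPLocalized` (27112),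
# at `p = 3`, ANY class number, ANY torsion depth, ANY Selmer corank — and the crux BY NAME modulo print plus its
# ONE typed-print residual (even `d_K ≠ -4`, `3 ∣ h_K`)

Cell `pub/bsd-print-x9`, seat `bsd-line-x10b-p2` (LEAD g11), write-crux stmt-BirchSwinnertonDyer-23729
`PrintX10b.HowardContainmentAnyClassNumberX10b` (aside r303; verdict «misstated» of gen 1 = FINDING PIN-1: the `∃ F` is
untied, hence μ-BLIND under rescaling). This file is the X10b TWIN of the x9-p1 LEAD's census closer for the X9 untied
light containment (`Theorems/PrintX9HowardContainmentLightFrameOfPrintOfNonvanishing.lean`, p681863): the SAME scaling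
reduction run at `p = 3` on class X10b, where the binders of 23729 carry NO parity, NO rank and NO `Ш` hypothesis.

* §1 `howardContainment_oddDisc_at_of_nonvanishing_of_cgs` — for a GIVEN `jbar`, on every X10b Heegner frame with
  `d_K` odd: `∃ D F X, I(ℋ_∞(F))² ⊆ char_Λ(X_tors)` from `hNV` (CGLS 2022 Thm. 4.1.1: `𝔖/Λκ_∞(C)` torsion,
  Cornut–Vatsal) and `hCGS` (CGS 2025 Thm. 6.5.2: `char(X_tors) = J²`, `J ∣ (3^m)·I(Λκ_∞(C))`, ANY corank — the
  "Moreover" clause of CGLS Thm. 4.1.3 is not available to 23729, which has no rank binder) = the route-free CORE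
  `UntiedHowardContainmentOfPrint.howardContainment_untied_of_thm411_of_thm652` (sibling module
  `PrintX10bUntiedHowardContainmentOfPrintCore`: coherent pair over the theorem `anticyclotomicTowerSharp`, Thm. 6.5.2
  package, Thm. 4.1.1 torsion along the reverse envelope, forward envelope, μ-blind promotion `F := 3^m • F₀` fed by (h1))
  run on the frame's `Thm413Hypotheses`, which `X10.thm413Hypotheses_of_classX10` proves on class X10b ((h1)
  `E(K)[3] = 0` is a theorem there) — NO residual irreducibility over `K`, NO `μ`-invariant, NO Howard / Mastella–Zerman input.
* §2 `howardContainmentAnyClassNumberX10b_oddDisc_of_nonvanishing_of_cgs` — the binders of 23729 VERBATIM plus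
  `Odd (NumberField.discr K)`, conclusion of 23729 (`jbar := IsAlgClosed.lift` along `ιC`).
* §3 `howardContainmentAnyClassNumberX10b_evenConductor_of_nonvanishing_of_cgs` — for curves of EVEN conductor the
  parity binder is free (`2 ∣ N_E` and (Heeg) force `2` split, so `d_K` odd): 23729's conclusion on EVERY frame.
* §4 THE CENSUS THEOREM `howardContainmentAnyClassNumberX10b_of_printLeaves_of_evenDiscResidual :
  CGLSHeegnerClassNonvanishing → CGSHowardDivisibilityPLocalized → MastellaZermanHowardDivisibility → R_even →
  HowardContainmentAnyClassNumberX10b` — the crux BY NAME from three cite-only leaves of `PrintX10b.closes` and the ONE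
  residual `R_even` := 23729's conclusion on the frames with `d_K` EVEN (`≠ -4`) and `3 ∣ h_K`, written out as a
  hypothesis (no definition): at `3 ∤ h_K` Mastella–Zerman Cor. 4.6 (`X10.heegnerContainment_of_cor46_of_not_surj`)
  has no parity hypothesis; at odd `d_K` §2; what is left is exactly the typed-print gap of CGLS 2022's standing
  hypothesis (disc) ("`D_K` odd and `≠ -3`", arXiv:2008.02571v2 TeX L248–249), inherited by CGS 2025 Thm. 6.5.2.
* §5 the registered regime stubs of the line `torsion-depth-x10b` (skeleton cf94ebb465a831ad) served CONDITIONALLY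
  (helpers, not stub credit; texts = the skeleton's `Stmt.stub_*` binders verbatim): `stub_depthZero_divisibleClassNumber`
  and `stub_depthPos_promotion` restricted to odd `d_K` ⟸ `hNV + hCGS` (their depth / localized-premiss binders idle),
  `stub_depthPos_localized_oddDisc` ⟸ `hNV + hCGS` (with `T`-exponent `0`).

HONEST FRAMING. (i) Kernel-valid AS TYPED and CONDITIONAL on the named cite-only leaves exactly as every row-10
closure is; (ii) per PIN-1 / R0 the untied `∃ F` does not pin the parametrisation — these theorems are the kernel
witness that 23729 is μ-BLIND on odd-`d_K` frames; they are NOT route currency and change no `closes`; (iii) the item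
23729 AS FILED stays open: its census is «⟸ 27103 + 27112 + 25233 + R_even», `R_even` having no printed source
(vacuous for even-conductor curves). «beyond-print theorem»: no. No summit statement is proved; BSD is NOT proved by
any of this.

References: [CastellaGrossiLeeSkinner2022] Thm. 4.1.1, Thm. 4.1.3, Rem. 4.1.4, §3.2/§4.1 standing hypotheses
(arXiv:2008.02571v2); [CastellaGrossiSkinner2025] Thm. 6.5.2 (Math. Ann. 393); [MastellaZerman2026] Cor. 4.6
(arXiv:2505.08710); [Howard2004HeegnerKolyvagin] §1, §3.3, Thm. B; [PerrinRiou1987BSMF] §1 p. 405, §3.3–3.4;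
[Cornut2002] (Mazur's conjecture).
-/

set_option linter.dupNamespace false
set_option autoImplicit false

noncomputable section

open scoped Classical Pointwise
open Literature Literature.NumberTheory.EllipticCurves WeierstrassCurve
  Literature.NumberTheory.EllipticCurves.ModularForms
  Literature.NumberTheory.EllipticCurves.CastellaGrossiLeeSkinner2022
open Literature.NumberTheory.EllipticCurves.Rank1Residual (ClassX10 Surj)
open Summit.BirchSwinnertonDyer.BirchSwinnertonDyer.Theses.PrintX10b
open Summit.BirchSwinnertonDyer.BirchSwinnertonDyer.Theorems

namespace Summit.BirchSwinnertonDyer.BirchSwinnertonDyer.Theorems.PrintX10bOfPrintOddDisc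

/-! ## §1 The untied containment for a GIVEN `jbar` on an odd-`d_K` X10b frame, from `hNV` and `hCGS` -/

/-- **Howard's untied containment on an odd-`d_K` X10b Heegner frame, for a given embedding `jbar`, from CGLS 2022
Thm. 4.1.1 (`CGLSHeegnerClassNonvanishing`) and CGS 2025 Thm. 6.5.2 (`CGSHowardDivisibilityPLocalized`)** — ANY class
number, ANY torsion depth, ANY Selmer corank: there are a `Λ`-adic Selmer datum `D`, a Heegner family `F` and a Selmer
dual `X` with `I(ℋ_∞(F))² ⊆ char_Λ(X_{Λ-tors})`. The route-free core
`UntiedHowardContainmentOfPrint.howardContainment_untied_of_thm411_of_thm652` (coherent pair over the theorem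
`anticyclotomicTowerSharp`, Thm. 6.5.2 package, Thm. 4.1.1 torsion, envelopes, μ-blind promotion `F := p^m • F₀` fed by
(h1)) on the frame's `Thm413Hypotheses` (`X10.thm413Hypotheses_of_classX10`). No `μ`-statement, no (irr_K), no rank
binder is used.
[cite: CastellaGrossiLeeSkinner2022, Thm. 4.1.1, Rem. 4.1.4, §3.2 (h1)] [cite: CastellaGrossiSkinner2025, Thm. 6.5.2]
[cite: Howard2004HeegnerKolyvagin, §1 ("Fixing a modular parametrization"), §3.3] [cite: PerrinRiou1987BSMF, §1 p. 405, §3.4 Prop. 10] -/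
theorem howardContainment_oddDisc_at_of_nonvanishing_of_cgs
    (hNV : CGLSHeegnerClassNonvanishing) (hCGS : CGSHowardDivisibilityPLocalized)
    {W : WeierstrassCurve ℚ} [W.IsElliptic] [W.IsGloballyMinimal] {p : ℕ} [Fact p.Prime]
    [NeZero (W.conductorNorm ℤ)] {K : Type} [Field K] [NumberField K]
    (hX : ClassX10 W p) (hK : IsImaginaryQuadratic K) (h3 : NumberField.discr K ≠ -3)
    (hHN : SatisfiesHeegnerHypothesis (W.conductorNorm ℤ) K) (hHp : SatisfiesHeegnerHypothesis p K)
    (hodd : Odd (NumberField.discr K)) {κ : ZpExtension K p} (hκ : κ.IsAnticyclotomic)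
    {γ : Field.absoluteGaloisGroup K} (hγ : κ.IsTopGenerator γ)
    (Dt : ModularParametrizationData W (W.conductorNorm ℤ))
    (H : HeegnerDatum (W.conductorNorm ℤ) (NumberField.discr K)) (jbar : AlgebraicClosure K →+* ℂ) :
    ∃ (D : (W.baseChange K).LambdaAdicSelmerData κ γ) (F : HeegnerFamily (W.conductorNorm ℤ) W K κ jbar)
      (X : (W.baseChange K).SelmerDualData κ γ),
      heegnerCharIdeal D F ^ 2 ≤
        Module.charIdeal (IwasawaAlgebra p) (Submodule.torsion (IwasawaAlgebra p) X.X) := by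
  -- the two leaves, by name (the route decls are the bodies of the Literature facts at universe 0)
  have h411 : thm411_torsionFree_heegnerClass_ne_bot_quotient_isTorsion.{0} := hNV
  have h652 : CastellaGrossiSkinner2025.thm652_stabilized_rankOne_charIdeal_torsion_dvd_pLocalized.{0} := hCGS
  -- the route-free core on the frame's `Thm413Hypotheses` (a theorem on odd-`d_K` X10b frames)
  exact UntiedHowardContainmentOfPrint.howardContainment_untied_of_thm411_of_thm652 h411 h652
    (Summit.BirchSwinnertonDyer.BirchSwinnertonDyer.Rank1Residual.X10.thm413Hypotheses_of_classX10 hX hK h3 hHN hHp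
      hodd hκ hγ) hHp hX.not_dvd_conductorNorm jbar Dt H

/-! ## §2 The crux's conclusion on every odd-`d_K` frame (binders of 23729 verbatim + `Odd (NumberField.discr K)`) -/

/-- **`HowardContainmentAnyClassNumberX10b` (stmt-BirchSwinnertonDyer-23729) RESTRICTED TO ODD `d_K`, from the two
cite-only leaves `CGLSHeegnerClassNonvanishing` (27103) and `CGSHowardDivisibilityPLocalized` (27112) BY NAME**: the
binders of the crux VERBATIM followed by `Odd (NumberField.discr K)`, then its conclusion
`∃ jbar D F X, I(ℋ_∞(F))² ⊆ char_Λ(X_tors)` (`jbar := IsAlgClosed.lift` along `ιC`; §1). Of the crux's binders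
`¬ Surj W 3`, `¬ W.HasCM`, `d_K ≠ -4` are idle. Kernel-valid AS TYPED; not route currency (PIN-1 / R0).
[cite: CastellaGrossiLeeSkinner2022, Thm. 4.1.1, Rem. 4.1.4] [cite: CastellaGrossiSkinner2025, Thm. 6.5.2] -/
theorem howardContainmentAnyClassNumberX10b_oddDisc_of_nonvanishing_of_cgs
    (hNV : CGLSHeegnerClassNonvanishing) (hCGS : CGSHowardDivisibilityPLocalized) :
    ∀ (W : WeierstrassCurve ℚ) [W.IsElliptic] [W.IsGloballyMinimal] (p : ℕ) [Fact p.Prime]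
      [NeZero (W.conductorNorm ℤ)] (K : Type) [Field K] [NumberField K],
      ClassX10 W p → ¬ Surj W 3 → ¬ W.HasCM →
      IsImaginaryQuadratic K → NumberField.discr K ≠ -3 → NumberField.discr K ≠ -4 →
      SatisfiesHeegnerHypothesis (W.conductorNorm ℤ) K → SatisfiesHeegnerHypothesis p K →
      ∀ (κ : ZpExtension K p), κ.IsAnticyclotomic → ∀ (γ : Field.absoluteGaloisGroup K),
      κ.IsTopGenerator γ →
      ∀ (Dt : ModularParametrizationData W (W.conductorNorm ℤ))
        (H : HeegnerDatum (W.conductorNorm ℤ) (NumberField.discr K)) (ιC : K →+* ℂ),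
      Odd (NumberField.discr K) →
      ∃ (jbar : AlgebraicClosure K →+* ℂ) (D : (W.baseChange K).LambdaAdicSelmerData κ γ)
        (F : HeegnerFamily (W.conductorNorm ℤ) W K κ jbar) (X : (W.baseChange K).SelmerDualData κ γ),
        heegnerCharIdeal D F ^ 2 ≤
          Module.charIdeal (IwasawaAlgebra p) (Submodule.torsion (IwasawaAlgebra p) X.X) := by
  intro W _ _ p _ _ K _ _ hX _hns _hcm hK h3 _h4 hHN hHp κ hκ γ hγ Dt H ιC hodd
  letI : Algebra K ℂ := ιC.toAlgebra
  let jbar : AlgebraicClosure K →+* ℂ :=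
    (IsAlgClosed.lift (R := K) (M := ℂ) (S := AlgebraicClosure K)).toRingHom
  obtain ⟨D, F, X, h⟩ :=
    howardContainment_oddDisc_at_of_nonvanishing_of_cgs hNV hCGS hX hK h3 hHN hHp hodd hκ hγ Dt H jbar
  exact ⟨jbar, D, F, X, h⟩

/-! ## §3 Even conductor: the parity binder is free -/

/-- **23729's conclusion on EVERY Heegner frame of an X10b curve of EVEN conductor**, from `hNV` and `hCGS`: the
parity binder of §2 is free — `2 ∣ N_E` and (Heeg) make `2` split in `K`, hence unramified, so `2 ∤ d_K`
(`not_dvd_discr_of_satisfiesHeegnerHypothesis`; the same remark as the tree's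
`UniversalToricDescentTwinSplit.odd_discr_of_satisfiesHeegnerHypothesis_of_two_dvd`, inlined here to keep this module's
imports on the Howard side). So the typed-print gap (disc) bites only for odd-conductor X10b curves.
[cite: CastellaGrossiLeeSkinner2022, §4.1 standing hypothesis (disc)] [cite: CastellaGrossiSkinner2025, Thm. 6.5.2] -/
theorem howardContainmentAnyClassNumberX10b_evenConductor_of_nonvanishing_of_cgs
    (hNV : CGLSHeegnerClassNonvanishing) (hCGS : CGSHowardDivisibilityPLocalized) :
    ∀ (W : WeierstrassCurve ℚ) [W.IsElliptic] [W.IsGloballyMinimal] (p : ℕ) [Fact p.Prime]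
      [NeZero (W.conductorNorm ℤ)] (K : Type) [Field K] [NumberField K],
      2 ∣ W.conductorNorm ℤ →
      ClassX10 W p → ¬ Surj W 3 → ¬ W.HasCM →
      IsImaginaryQuadratic K → NumberField.discr K ≠ -3 → NumberField.discr K ≠ -4 →
      SatisfiesHeegnerHypothesis (W.conductorNorm ℤ) K → SatisfiesHeegnerHypothesis p K →
      ∀ (κ : ZpExtension K p), κ.IsAnticyclotomic → ∀ (γ : Field.absoluteGaloisGroup K),
      κ.IsTopGenerator γ →
      ∀ (Dt : ModularParametrizationData W (W.conductorNorm ℤ))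
        (H : HeegnerDatum (W.conductorNorm ℤ) (NumberField.discr K)) (ιC : K →+* ℂ),
      ∃ (jbar : AlgebraicClosure K →+* ℂ) (D : (W.baseChange K).LambdaAdicSelmerData κ γ)
        (F : HeegnerFamily (W.conductorNorm ℤ) W K κ jbar) (X : (W.baseChange K).SelmerDualData κ γ),
        heegnerCharIdeal D F ^ 2 ≤
          Module.charIdeal (IwasawaAlgebra p) (Submodule.torsion (IwasawaAlgebra p) X.X) := by
  intro W _ _ p _ _ K _ _ h2 hX hns hcm hK h3 h4 hHN hHp κ hκ γ hγ Dt H ιC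
  -- `2 ∣ N_E` + (Heeg) ⇒ `2` split ⇒ `2 ∤ d_K` ⇒ `d_K` odd
  have hnd : ¬ ((2 : ℕ) : ℤ) ∣ NumberField.discr K :=
    not_dvd_discr_of_satisfiesHeegnerHypothesis hK hHN Nat.prime_two h2
  have hodd : Odd (NumberField.discr K) :=
    Int.not_even_iff_odd.mp fun h ↦ hnd (by exact_mod_cast even_iff_two_dvd.mp h)
  exact howardContainmentAnyClassNumberX10b_oddDisc_of_nonvanishing_of_cgs hNV hCGS W p K hX hns hcm hK h3 h4 hHN
    hHp κ hκ γ hγ Dt H ιC hodd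

/-! ## §4 The census theorem: the crux BY NAME from three print leaves and the ONE typed-print residual -/

/-- **CENSUS OF stmt-BirchSwinnertonDyer-23729 IN THE KERNEL.** `HowardContainmentAnyClassNumberX10b` follows BY NAME
from three cite-only leaves of `PrintX10b.closes` — CGLS 2022 Thm. 4.1.1 (`CGLSHeegnerClassNonvanishing`, 27103),
CGS 2025 Thm. 6.5.2 (`CGSHowardDivisibilityPLocalized`, 27112), Mastella–Zerman 2026 Cor. 4.6
(`MastellaZermanHowardDivisibility`, 25233) — and ONE residual hypothesis `R_even`: the crux's own conclusion on the
frames with `d_K` EVEN and `p ∣ h_K` (spelled out; binders of the crux verbatim + `¬ Odd (NumberField.discr K)` +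
`p ∣ NumberField.classNumber K`). Split: odd `d_K` ↦ §2; even `d_K`, `p ∤ h_K` ↦
`X10.heegnerContainment_of_cor46_of_not_surj` (MZ26 Cor. 4.6 at `3`, scalar image `1 + 3ℤ₃`, NO parity hypothesis);
even `d_K`, `p ∣ h_K` ↦ `R_even`, which has NO printed source (CGLS 2022 §4.1 standing (disc) "`D_K` odd",
inherited by CGS 2025 Thm. 6.5.2; Howard 2004 Thm. B / MZ26 assume `p ∤ h_K`) and is VACUOUS for even-conductor
curves (§3). CONDITIONAL; credits nothing by itself; the item as filed stays open.
[cite: CastellaGrossiLeeSkinner2022, Thm. 4.1.1, Rem. 4.1.4, §4.1 (disc) (arXiv:2008.02571v2 TeX L248–249)]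
[cite: CastellaGrossiSkinner2025, Thm. 6.5.2] [cite: MastellaZerman2026, Cor. 4.6] [cite: LombardoTronto2022, Prop. 3.12] -/
theorem howardContainmentAnyClassNumberX10b_of_printLeaves_of_evenDiscResidual
    (hNV : CGLSHeegnerClassNonvanishing) (hCGS : CGSHowardDivisibilityPLocalized)
    (hMZ : MastellaZermanHowardDivisibility)
    (hEven : ∀ (W : WeierstrassCurve ℚ) [W.IsElliptic] [W.IsGloballyMinimal] (p : ℕ) [Fact p.Prime]
      [NeZero (W.conductorNorm ℤ)] (K : Type) [Field K] [NumberField K],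
      ClassX10 W p → ¬ Surj W 3 → ¬ W.HasCM →
      IsImaginaryQuadratic K → NumberField.discr K ≠ -3 → NumberField.discr K ≠ -4 →
      SatisfiesHeegnerHypothesis (W.conductorNorm ℤ) K → SatisfiesHeegnerHypothesis p K →
      ∀ (κ : ZpExtension K p), κ.IsAnticyclotomic → ∀ (γ : Field.absoluteGaloisGroup K),
      κ.IsTopGenerator γ →
      ∀ (Dt : ModularParametrizationData W (W.conductorNorm ℤ))
        (H : HeegnerDatum (W.conductorNorm ℤ) (NumberField.discr K)) (ιC : K →+* ℂ),
      ¬ Odd (NumberField.discr K) → p ∣ NumberField.classNumber K →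
      ∃ (jbar : AlgebraicClosure K →+* ℂ) (D : (W.baseChange K).LambdaAdicSelmerData κ γ)
        (F : HeegnerFamily (W.conductorNorm ℤ) W K κ jbar) (X : (W.baseChange K).SelmerDualData κ γ),
        heegnerCharIdeal D F ^ 2 ≤
          Module.charIdeal (IwasawaAlgebra p) (Submodule.torsion (IwasawaAlgebra p) X.X)) :
    HowardContainmentAnyClassNumberX10b := by
  intro W _ _ p _ _ K _ _ hX hns hcm hK h3 h4 hHN hHp κ hκ γ hγ Dt H ιC
  by_cases hodd : Odd (NumberField.discr K)
  · exact howardContainmentAnyClassNumberX10b_oddDisc_of_nonvanishing_of_cgs hNV hCGS W p K hX hns hcm hK h3 h4 hHN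
      hHp κ hκ γ hγ Dt H ιC hodd
  · by_cases hh : p ∣ NumberField.classNumber K
    · exact hEven W p K hX hns hcm hK h3 h4 hHN hHp κ hκ γ hγ Dt H ιC hodd hh
    · have h46 : MastellaZerman2026.cor46_howardDivisibility_of_scalarImage.{0} := hMZ
      exact Summit.BirchSwinnertonDyer.BirchSwinnertonDyer.Rank1Residual.X10.heegnerContainment_of_cor46_of_not_surj
        h46 hX hns hcm hK h3 h4 hHN hHp hh κ hκ γ hγ Dt H ιC

/-- **The same census for EVEN-conductor X10b curves needs NO residual**: `2 ∣ N_E` makes `R_even` vacuous (§3), so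
on such curves 23729's conclusion follows from `hNV` and `hCGS` alone on every frame (Mastella–Zerman idle too).
[cite: CastellaGrossiLeeSkinner2022, Thm. 4.1.1] [cite: CastellaGrossiSkinner2025, Thm. 6.5.2] -/
theorem howardContainmentAnyClassNumberX10b_of_printLeaves_of_oddConductorResidual
    (hNV : CGLSHeegnerClassNonvanishing) (hCGS : CGSHowardDivisibilityPLocalized)
    (hOdd : ∀ (W : WeierstrassCurve ℚ) [W.IsElliptic] [W.IsGloballyMinimal] (p : ℕ) [Fact p.Prime]
      [NeZero (W.conductorNorm ℤ)] (K : Type) [Field K] [NumberField K],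
      ¬ 2 ∣ W.conductorNorm ℤ →
      ClassX10 W p → ¬ Surj W 3 → ¬ W.HasCM →
      IsImaginaryQuadratic K → NumberField.discr K ≠ -3 → NumberField.discr K ≠ -4 →
      SatisfiesHeegnerHypothesis (W.conductorNorm ℤ) K → SatisfiesHeegnerHypothesis p K →
      ∀ (κ : ZpExtension K p), κ.IsAnticyclotomic → ∀ (γ : Field.absoluteGaloisGroup K),
      κ.IsTopGenerator γ →
      ∀ (Dt : ModularParametrizationData W (W.conductorNorm ℤ))
        (H : HeegnerDatum (W.conductorNorm ℤ) (NumberField.discr K)) (ιC : K →+* ℂ),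
      ¬ Odd (NumberField.discr K) →
      ∃ (jbar : AlgebraicClosure K →+* ℂ) (D : (W.baseChange K).LambdaAdicSelmerData κ γ)
        (F : HeegnerFamily (W.conductorNorm ℤ) W K κ jbar) (X : (W.baseChange K).SelmerDualData κ γ),
        heegnerCharIdeal D F ^ 2 ≤
          Module.charIdeal (IwasawaAlgebra p) (Submodule.torsion (IwasawaAlgebra p) X.X)) :
    HowardContainmentAnyClassNumberX10b := by
  intro W _ _ p _ _ K _ _ hX hns hcm hK h3 h4 hHN hHp κ hκ γ hγ Dt H ιC
  by_cases hodd : Odd (NumberField.discr K)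
  · exact howardContainmentAnyClassNumberX10b_oddDisc_of_nonvanishing_of_cgs hNV hCGS W p K hX hns hcm hK h3 h4 hHN
      hHp κ hκ γ hγ Dt H ιC hodd
  · by_cases h2 : 2 ∣ W.conductorNorm ℤ
    · exact howardContainmentAnyClassNumberX10b_evenConductor_of_nonvanishing_of_cgs hNV hCGS W p K h2 hX hns hcm hK
        h3 h4 hHN hHp κ hκ γ hγ Dt H ιC
    · exact hOdd W p K h2 hX hns hcm hK h3 h4 hHN hHp κ hκ γ hγ Dt H ιC hodd

/-! ## §5 The registered regime stubs of line `torsion-depth-x10b` (skeleton cf94ebb465a831ad), served conditionally -/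

/-- **Regime stub `stub_depthZero_divisibleClassNumber` (text of the skeleton's `Stmt.stub_depthZero_divisibleClassNumber`
VERBATIM) ON ODD-`d_K` FRAMES, from `hNV` and `hCGS`**: its class-number and depth binders (`p ∣ h_K`,
`¬ (ringClassSubgroup K 1 jbar ≤ κ.layerSubgroup 1)`) are idle — §1 holds at every depth. CONDITIONAL helper (extra
leading binders `hNV`, `hCGS`, `Odd d_K`), not stub credit. [cite: CastellaGrossiLeeSkinner2022, Thm. 4.1.1]
[cite: CastellaGrossiSkinner2025, Thm. 6.5.2] [cite: Howard2007, §3.3 (torsion depth δ)] -/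
theorem stub_depthZero_divisibleClassNumber_oddDisc_of_nonvanishing_of_cgs
    (hNV : CGLSHeegnerClassNonvanishing) (hCGS : CGSHowardDivisibilityPLocalized) :
    ∀ (W : WeierstrassCurve ℚ) [W.IsElliptic] [W.IsGloballyMinimal] (p : ℕ) [Fact p.Prime]
      [NeZero (W.conductorNorm ℤ)] (K : Type) [Field K] [NumberField K],
      ClassX10 W p → ¬ Surj W 3 → ¬ W.HasCM →
      IsImaginaryQuadratic K → NumberField.discr K ≠ -3 → NumberField.discr K ≠ -4 →
      SatisfiesHeegnerHypothesis (W.conductorNorm ℤ) K → SatisfiesHeegnerHypothesis p K →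
      ∀ (κ : ZpExtension K p), κ.IsAnticyclotomic → ∀ (γ : Field.absoluteGaloisGroup K),
      κ.IsTopGenerator γ →
      ∀ (Dt : ModularParametrizationData W (W.conductorNorm ℤ))
        (H : HeegnerDatum (W.conductorNorm ℤ) (NumberField.discr K)) (ιC : K →+* ℂ)
        (jbar : AlgebraicClosure K →+* ℂ),
      Odd (NumberField.discr K) →
      p ∣ NumberField.classNumber K →
      ¬ (ringClassSubgroup K 1 jbar ≤ κ.layerSubgroup 1) →
      ∃ (D : (W.baseChange K).LambdaAdicSelmerData κ γ)
        (F : HeegnerFamily (W.conductorNorm ℤ) W K κ jbar) (X : (W.baseChange K).SelmerDualData κ γ),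
        heegnerCharIdeal D F ^ 2 ≤
          Module.charIdeal (IwasawaAlgebra p) (Submodule.torsion (IwasawaAlgebra p) X.X) := by
  intro W _ _ p _ _ K _ _ hX _hns _hcm hK h3 _h4 hHN hHp κ hκ γ hγ Dt H _ιC jbar hodd _hh _hδ
  exact howardContainment_oddDisc_at_of_nonvanishing_of_cgs hNV hCGS hX hK h3 hHN hHp hodd hκ hγ Dt H jbar

/-- **Regime stub `stub_depthPos_promotion` (text of the skeleton's `Stmt.stub_depthPos_promotion` VERBATIM) ON
ODD-`d_K` FRAMES, from `hNV` and `hCGS`**: both its depth binder and its localized-containment premiss are idle (§1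
proves the integral containment outright for some `F`). CONDITIONAL helper, not stub credit.
[cite: CastellaGrossiLeeSkinner2022, Thm. 4.1.1, Thm. 4.1.3] [cite: CastellaGrossiSkinner2025, Thm. 6.5.2] -/
theorem stub_depthPos_promotion_oddDisc_of_nonvanishing_of_cgs
    (hNV : CGLSHeegnerClassNonvanishing) (hCGS : CGSHowardDivisibilityPLocalized) :
    ∀ (W : WeierstrassCurve ℚ) [W.IsElliptic] [W.IsGloballyMinimal] (p : ℕ) [Fact p.Prime]
      [NeZero (W.conductorNorm ℤ)] (K : Type) [Field K] [NumberField K],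
      ClassX10 W p → ¬ Surj W 3 → ¬ W.HasCM →
      IsImaginaryQuadratic K → NumberField.discr K ≠ -3 → NumberField.discr K ≠ -4 →
      SatisfiesHeegnerHypothesis (W.conductorNorm ℤ) K → SatisfiesHeegnerHypothesis p K →
      ∀ (κ : ZpExtension K p), κ.IsAnticyclotomic → ∀ (γ : Field.absoluteGaloisGroup K),
      κ.IsTopGenerator γ →
      ∀ (Dt : ModularParametrizationData W (W.conductorNorm ℤ))
        (H : HeegnerDatum (W.conductorNorm ℤ) (NumberField.discr K)) (ιC : K →+* ℂ)
        (jbar : AlgebraicClosure K →+* ℂ),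
      Odd (NumberField.discr K) →
      ringClassSubgroup K 1 jbar ≤ κ.layerSubgroup 1 →
      (∃ (D : (W.baseChange K).LambdaAdicSelmerData κ γ)
        (F : HeegnerFamily (W.conductorNorm ℤ) W K κ jbar) (X : (W.baseChange K).SelmerDualData κ γ)
        (m n : ℕ),
        Ideal.span {((p : IwasawaAlgebra p) ^ m * (PowerSeries.X : IwasawaAlgebra p) ^ n)} *
            heegnerCharIdeal D F ^ 2 ≤
          Module.charIdeal (IwasawaAlgebra p) (Submodule.torsion (IwasawaAlgebra p) X.X)) →
      ∃ (D : (W.baseChange K).LambdaAdicSelmerData κ γ)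
        (F : HeegnerFamily (W.conductorNorm ℤ) W K κ jbar) (X : (W.baseChange K).SelmerDualData κ γ),
        heegnerCharIdeal D F ^ 2 ≤
          Module.charIdeal (IwasawaAlgebra p) (Submodule.torsion (IwasawaAlgebra p) X.X) := by
  intro W _ _ p _ _ K _ _ hX _hns _hcm hK h3 _h4 hHN hHp κ hκ γ hγ Dt H _ιC jbar hodd _hδ _hloc
  exact howardContainment_oddDisc_at_of_nonvanishing_of_cgs hNV hCGS hX hK h3 hHN hHp hodd hκ hγ Dt H jbar

/-- **Regime stub `stub_depthPos_localized_oddDisc` (text of the skeleton's `Stmt.stub_depthPos_localized_oddDisc`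
VERBATIM), from `hNV` and `hCGS`** with exponents `(m, n) = (0, 0)`: the integral containment of §1 is the localized
one with unit factor. CONDITIONAL helper, not stub credit (the skeleton's own reduction
`stub_depthPos_localized_oddDisc_of_thm413` needs the unproved module comparison `Stmt.cmp_familyLeStabilized`; here the
coherent-pair envelope replaces it). [cite: CastellaGrossiLeeSkinner2022, Thm. 4.1.1, Thm. 4.1.3 (i)–(ii), Rem. 4.1.4]
[cite: CastellaGrossiSkinner2025, Thm. 6.5.2] -/
theorem stub_depthPos_localized_oddDisc_of_nonvanishing_of_cgs
    (hNV : CGLSHeegnerClassNonvanishing) (hCGS : CGSHowardDivisibilityPLocalized) :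
    ∀ (W : WeierstrassCurve ℚ) [W.IsElliptic] [W.IsGloballyMinimal] (p : ℕ) [Fact p.Prime]
      [NeZero (W.conductorNorm ℤ)] (K : Type) [Field K] [NumberField K],
      ClassX10 W p → ¬ Surj W 3 → ¬ W.HasCM →
      IsImaginaryQuadratic K → NumberField.discr K ≠ -3 → NumberField.discr K ≠ -4 →
      SatisfiesHeegnerHypothesis (W.conductorNorm ℤ) K → SatisfiesHeegnerHypothesis p K →
      ∀ (κ : ZpExtension K p), κ.IsAnticyclotomic → ∀ (γ : Field.absoluteGaloisGroup K),
      κ.IsTopGenerator γ →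
      ∀ (Dt : ModularParametrizationData W (W.conductorNorm ℤ))
        (H : HeegnerDatum (W.conductorNorm ℤ) (NumberField.discr K)) (ιC : K →+* ℂ)
        (jbar : AlgebraicClosure K →+* ℂ),
      Odd (NumberField.discr K) →
      ∃ (D : (W.baseChange K).LambdaAdicSelmerData κ γ)
        (F : HeegnerFamily (W.conductorNorm ℤ) W K κ jbar) (X : (W.baseChange K).SelmerDualData κ γ)
        (m n : ℕ),
        Ideal.span {((p : IwasawaAlgebra p) ^ m * (PowerSeries.X : IwasawaAlgebra p) ^ n)} *
            heegnerCharIdeal D F ^ 2 ≤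
          Module.charIdeal (IwasawaAlgebra p) (Submodule.torsion (IwasawaAlgebra p) X.X) := by
  intro W _ _ p _ _ K _ _ hX _hns _hcm hK h3 _h4 hHN hHp κ hκ γ hγ Dt H _ιC jbar hodd
  obtain ⟨D, F, X, h⟩ :=
    howardContainment_oddDisc_at_of_nonvanishing_of_cgs hNV hCGS hX hK h3 hHN hHp hodd hκ hγ Dt H jbar
  refine ⟨D, F, X, 0, 0, ?_⟩
  rw [pow_zero, pow_zero, mul_one, Ideal.span_singleton_one, Ideal.top_mul]
  exact h

end Summit.BirchSwinnertonDyer.BirchSwinnertonDyer.Theorems.PrintX10bOfPrintOddDisc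

end
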